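import Literature.Analysis.FluidPDE.CylindricalGenerator
import Mathlib.Analysis.Calculus.BumpFunction.FiniteDimension
import Mathlib.Analysis.Calculus.BumpFunction.InnerProduct
import HarnessLib

/-!
# Stub `stub_cylindricalCombination` (S3a) of the line `dissipation-deficit-duality`
# (crux stmt-AnomalousDissipation-14091, `TaylorCertificates.FloorCertificate`)

LINEAR COMBINATIONS OF CYLINDRICAL TEST FUNCTIONALS ARE REALISED ON EVERY BALL OF `H`: for reals
`a, b`, a radius² `ρ` and cylindrical test functionals `Φ₁, Φ₂` (FMRT 2001, Ch. IV §1.2 Def. 1.2;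
`Torus.CylindricalTest`) there is ONE cylindrical `Φ₀` with `Φ₀'(u) = a Φ₁'(u) + b Φ₂'(u)` (as test
fields on `T³`) at every `u ∈ H` with `|u|² ≤ ρ`.

Construction: concatenate the coordinates (`m₀ = m₁ + m₂`, `g₀ = Fin.append g₁ g₂`), let
`π₁, π₂` be the coordinate projections `ℝ^{m₀} → ℝ^{m₁}, ℝ^{m₂}` (continuous linear), and take the
profile `φ₀(z) = χ(z) · (a φ₁(π₁ z) + b φ₂(π₂ z))` with `χ` a smooth bump centred at `0` that is
`≡ 1` on the (bounded) coordinate image of the ball `{|u|² ≤ ρ}` (`|(u, gᵢ)| ≤ |u| ‖gᵢ‖_{L²}`,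
`Torus.abs_pairing_coe_le`). Then `φ₀ ∈ C¹_c(ℝ^{m₀})` and, near the coordinates of any `u` in the
ball, `φ₀` agrees with `a φ₁ ∘ π₁ + b φ₂ ∘ π₂`, so `∂φ₀ = a (∂φ₁ ∘ π₁) π₁ + b (∂φ₂ ∘ π₂) π₂` there
(`Filter.EventuallyEq.fderiv_eq`, chain rule), whence `Φ₀'(u) = Σᵢ ∂ᵢφ₀ g₀ᵢ = a Φ₁'(u) + b Φ₂'(u)`
(`Fin.sum_univ_add`). Globally (without the cutoff `χ`) the statement is false: `a φ₁(x) + b φ₂(y)`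
is not compactly supported on `ℝ^{m₁+m₂}`.

References: C. Foias, O. Manley, R. Rosa, R. Temam, *Navier–Stokes Equations and Turbulence*
(Cambridge Univ. Press, 2001), Ch. IV §1.2 Def. 1.2 and the display after (1.27).
-/

-- `Summit.<Summit>.<Problem>` is the tree's mandated summit-side namespace; for this
-- single-conjunct summit the two coincide, so the duplicate is deliberate.
set_option linter.dupNamespace false

noncomputable section

namespace Summit.AnomalousDissipation.AnomalousDissipation.Theorems.TaylorCertificatesFloorCertificate

open MeasureTheory Filter Topology
open Literature.Analysis.FunctionSpaces Literature.Analysis.FluidPDE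

/-! ## Finite-dimensional bookkeeping -/

/-- Coordinate re-indexing `z ↦ (z_{σ i})ᵢ` is a continuous linear map `ℝ^l → ℝ^k` between
Euclidean spaces. [folklore] -/
theorem exists_reindexCLM {k l : ℕ} (σ : Fin k → Fin l) :
    ∃ π : EuclideanSpace ℝ (Fin l) →L[ℝ] EuclideanSpace ℝ (Fin k), ∀ z i, π z i = z (σ i) :=
  ⟨((EuclideanSpace.equiv (Fin k) ℝ).symm : (Fin k → ℝ) →L[ℝ] EuclideanSpace ℝ (Fin k)).comp
      (ContinuousLinearMap.pi fun i => EuclideanSpace.proj (σ i)), fun _ _ => rfl⟩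

/-- **The cut-off profile.** Given continuous linear `π₁ : ℝ^k → ℝ^m`, `π₂ : ℝ^k → ℝ^n`, `C¹`
profiles `φ₁, φ₂`, reals `a, b` and a radius `R`, there is a compactly supported `C¹` profile
`φ₀ : ℝ^k → ℝ` whose differential on the closed ball of radius `R` is
`a (φ₁' ∘ π₁) π₁ + b (φ₂' ∘ π₂) π₂`: take `φ₀ = χ · (a φ₁ ∘ π₁ + b φ₂ ∘ π₂)` with `χ` a smooth bump,
`χ ≡ 1` on the ball of radius `R + 1`. [folklore] -/
theorem exists_cutoffProfile {k m n : ℕ}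
    (π₁ : EuclideanSpace ℝ (Fin k) →L[ℝ] EuclideanSpace ℝ (Fin m))
    (π₂ : EuclideanSpace ℝ (Fin k) →L[ℝ] EuclideanSpace ℝ (Fin n))
    {φ₁ : EuclideanSpace ℝ (Fin m) → ℝ} {φ₂ : EuclideanSpace ℝ (Fin n) → ℝ}
    (h₁ : ContDiff ℝ 1 φ₁) (h₂ : ContDiff ℝ 1 φ₂) (a b R : ℝ) :
    ∃ φ₀ : EuclideanSpace ℝ (Fin k) → ℝ, ContDiff ℝ 1 φ₀ ∧ HasCompactSupport φ₀ ∧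
      ∀ z : EuclideanSpace ℝ (Fin k), ‖z‖ ≤ R →
        fderiv ℝ φ₀ z = a • (fderiv ℝ φ₁ (π₁ z)).comp π₁ + b • (fderiv ℝ φ₂ (π₂ z)).comp π₂ := by
  -- the bump, `≡ 1` on the closed ball of radius `max R 0 + 1`
  let χ : ContDiffBump (0 : EuclideanSpace ℝ (Fin k)) :=
    ⟨max R 0 + 1, max R 0 + 2, by positivity, by linarith⟩
  -- the uncut profile and its differential
  set ψ : EuclideanSpace ℝ (Fin k) → ℝ := fun z => a * φ₁ (π₁ z) + b * φ₂ (π₂ z) with hψ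
  have hψd : ∀ z, HasFDerivAt ψ
      (a • (fderiv ℝ φ₁ (π₁ z)).comp π₁ + b • (fderiv ℝ φ₂ (π₂ z)).comp π₂) z := by
    intro z
    have e₁ : HasFDerivAt (fun y => φ₁ (π₁ y)) ((fderiv ℝ φ₁ (π₁ z)).comp π₁) z :=
      ((h₁.differentiable one_ne_zero) (π₁ z)).hasFDerivAt.comp z π₁.hasFDerivAt
    have e₂ : HasFDerivAt (fun y => φ₂ (π₂ y)) ((fderiv ℝ φ₂ (π₂ z)).comp π₂) z :=
      ((h₂.differentiable one_ne_zero) (π₂ z)).hasFDerivAt.comp z π₂.hasFDerivAt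
    exact (e₁.const_mul a).add (e₂.const_mul b)
  refine ⟨fun z => χ z * ψ z, ?_, ?_, fun z hz => ?_⟩
  · exact χ.contDiff.mul ((contDiff_const.mul (h₁.comp π₁.contDiff)).add
      (contDiff_const.mul (h₂.comp π₂.contDiff)))
  · exact χ.hasCompactSupport.mul_right
  · have hball : z ∈ Metric.ball (0 : EuclideanSpace ℝ (Fin k)) χ.rIn := by
      rw [mem_ball_zero_iff]
      show ‖z‖ < max R 0 + 1
      have := le_max_left R 0
      linarith
    have hev : (fun y => χ y * ψ y) =ᶠ[𝓝 z] ψ := by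
      filter_upwards [χ.eventuallyEq_one_of_mem_ball hball] with y hy
      rw [hy, Pi.one_apply, one_mul]
    rw [hev.fderiv_eq]
    exact (hψd z).fderiv

/-! ## Concatenating the test fields and bounding the coordinates -/

/-- Concatenation `g₀ = (g₁, g₂)` of the test fields of two cylindrical test functionals: smooth,
divergence-free, mean-zero, with `g₀ (castAdd i) = g₁ i` and `g₀ (natAdd j) = g₂ j`. [folklore] -/
theorem exists_appendFields (Φ₁ Φ₂ : Torus.CylindricalTest (Fin 3)) :
    ∃ g₀ : Fin (Φ₁.m + Φ₂.m) → UnitAddTorus (Fin 3) → EuclideanSpace ℝ (Fin 3),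
      (∀ i, Torus.IsSmooth (g₀ i)) ∧ (∀ i, Torus.IsDivFree (g₀ i)) ∧
      (∀ i, Torus.HasZeroMean (g₀ i)) ∧
      (∀ i, g₀ (Fin.castAdd Φ₂.m i) = Φ₁.g i) ∧ (∀ j, g₀ (Fin.natAdd Φ₁.m j) = Φ₂.g j) := by
  have key : ∀ P : (UnitAddTorus (Fin 3) → EuclideanSpace ℝ (Fin 3)) → Prop,
      (∀ i, P (Φ₁.g i)) → (∀ j, P (Φ₂.g j)) → ∀ i, P (Fin.append Φ₁.g Φ₂.g i) :=
      fun P hP₁ hP₂ i =>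
    Fin.addCases (motive := fun i => P (Fin.append Φ₁.g Φ₂.g i))
      (fun i => by rw [Fin.append_left]; exact hP₁ i)
      (fun j => by rw [Fin.append_right]; exact hP₂ j) i
  exact ⟨Fin.append Φ₁.g Φ₂.g, key _ Φ₁.g_smooth Φ₂.g_smooth, key _ Φ₁.g_divFree Φ₂.g_divFree,
    key _ Φ₁.g_zeroMean Φ₂.g_zeroMean, fun i => Fin.append_left _ _ i,
    fun j => Fin.append_right _ _ j⟩

/-- The coordinates `((u, g₁), …, (u, gₘ))` of the ball `{|u|² ≤ ρ}` of `H` are bounded in `ℝ^m`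
(Cauchy–Schwarz `|(u, gᵢ)| ≤ |u| ‖gᵢ‖_{L²}`, `Torus.abs_pairing_coe_le`). [folklore] -/
theorem exists_norm_coords_le {m : ℕ} (g : Fin m → UnitAddTorus (Fin 3) → EuclideanSpace ℝ (Fin 3))
    (hg : ∀ i, Torus.IsSmooth (g i)) (ρ : ℝ) :
    ∃ R : ℝ, ∀ u : Torus.energySpace (Fin 3), ‖u‖ ^ 2 ≤ ρ →
      ‖(WithLp.toLp 2 fun i => Torus.pairing u.1 (g i) : EuclideanSpace ℝ (Fin m))‖ ≤ R := by
  refine ⟨√(∑ i, (√(max ρ 0) * ‖((hg i).memLp 2).toLp (g i)‖) ^ 2), fun u hu => ?_⟩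
  have hu' : ‖u‖ ≤ √(max ρ 0) := by
    have h := Real.abs_le_sqrt (hu.trans (le_max_left ρ 0))
    rwa [abs_norm] at h
  rw [EuclideanSpace.norm_eq]
  refine Real.sqrt_le_sqrt (Finset.sum_le_sum fun i _ => ?_)
  rw [PiLp.toLp_apply, Real.norm_eq_abs]
  refine pow_le_pow_left₀ (abs_nonneg _) ?_ 2
  exact (Torus.abs_pairing_coe_le ((hg i).memLp 2) u).trans
    (mul_le_mul_of_nonneg_right hu' (norm_nonneg _))

/-! ## The stub -/

/-- **S3a `stub_cylindricalCombination`** — LINEAR COMBINATIONS OF CYLINDRICAL TEST FUNCTIONALS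
ARE REALISED ON EVERY BALL: for reals `a, b`, a radius² `ρ` and cylindrical `Φ₁, Φ₂` there is ONE
cylindrical `Φ₀` with `Φ₀'(u) = aΦ₁'(u) + bΦ₂'(u)` (as test fields) at every `u` with `|u|² ≤ ρ`.
Proof: concatenate the coordinates (`m₀ = m₁ + m₂`, `g₀ = Fin.append g₁ g₂`), take the profile
`φ₀(z) = χ(z)·(a φ₁(π₁ z) + b φ₂(π₂ z))` with `π₁, π₂` the coordinate projections and `χ` a smooth
bump centred at `0` that is `≡ 1` on the coordinate image of the ball (`exists_cutoffProfile`,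
`exists_norm_coords_le`); on the ball
`fderiv φ₀ = a (fderiv φ₁ ∘ π₁) π₁ + b (fderiv φ₂ ∘ π₂) π₂`, whence
`Φ₀'(u) = Σᵢ ∂ᵢφ₀ g₀ᵢ = aΦ₁'(u) + bΦ₂'(u)` (`Fin.sum_univ_add`). With `a = b = 0` it yields a test
functional flat on the ball. [cite: FMRTTurbulence2001, Ch. IV §1.2 Def. 1.2 (cylindrical test
functionals Φ(u) = φ((u,g₁),…,(u,gₘ)) and Φ'(u) = Σⱼ ∂ⱼφ gⱼ)] -/
theorem stub_cylindricalCombination :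
    ∀ (ρ a b : ℝ) (Φ₁ Φ₂ : Torus.CylindricalTest (Fin 3)), ∃ Φ₀ : Torus.CylindricalTest (Fin 3),
      ∀ u : Torus.energySpace (Fin 3), ‖u‖ ^ 2 ≤ ρ → Φ₀.grad u = a • Φ₁.grad u + b • Φ₂.grad u := by
  intro ρ a b Φ₁ Φ₂
  obtain ⟨g₀, hs, hd, hz, hl, hr⟩ := exists_appendFields Φ₁ Φ₂
  obtain ⟨π₁, hπ₁⟩ := exists_reindexCLM (Fin.castAdd Φ₂.m : Fin Φ₁.m → Fin (Φ₁.m + Φ₂.m))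
  obtain ⟨π₂, hπ₂⟩ := exists_reindexCLM (Fin.natAdd Φ₁.m : Fin Φ₂.m → Fin (Φ₁.m + Φ₂.m))
  obtain ⟨R, hR⟩ := exists_norm_coords_le g₀ hs ρ
  obtain ⟨φ₀, hφc, hφs, hφd⟩ :=
    exists_cutoffProfile π₁ π₂ Φ₁.φ_contDiff Φ₂.φ_contDiff a b R
  refine ⟨⟨Φ₁.m + Φ₂.m, g₀, hs, hd, hz, φ₀, hφc, hφs⟩, fun u hu => ?_⟩
  -- the coordinate projections of the concatenated coordinates
  have hc₁ : π₁ (WithLp.toLp 2 fun i => Torus.pairing u.1 (g₀ i)) = Φ₁.coords u := by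
    ext i
    rw [hπ₁, PiLp.toLp_apply, hl]
    rfl
  have hc₂ : π₂ (WithLp.toLp 2 fun i => Torus.pairing u.1 (g₀ i)) = Φ₂.coords u := by
    ext j
    rw [hπ₂, PiLp.toLp_apply, hr]
    rfl
  -- the coordinate projections of the basis vectors
  have hne : ∀ (i : Fin Φ₁.m) (j : Fin Φ₂.m),
      (Fin.natAdd Φ₁.m j : Fin (Φ₁.m + Φ₂.m)) ≠ Fin.castAdd Φ₂.m i := fun i j h => by
    have h' := congrArg Fin.val h
    rw [Fin.val_natAdd, Fin.val_castAdd] at h'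
    have := i.isLt
    omega
  have he₁ : ∀ i : Fin Φ₁.m, π₁ (EuclideanSpace.single (Fin.castAdd Φ₂.m i) (1 : ℝ)) =
      EuclideanSpace.single i 1 := fun i => by
    ext i'
    rw [hπ₁, PiLp.single_apply, PiLp.single_apply]
    simp only [Fin.castAdd_inj]
  have he₂ : ∀ i : Fin Φ₁.m, π₂ (EuclideanSpace.single (Fin.castAdd Φ₂.m i) (1 : ℝ)) = 0 :=
      fun i => by
    ext j
    rw [hπ₂, PiLp.single_apply, PiLp.zero_apply, if_neg (hne i j)]
  have hf₁ : ∀ j : Fin Φ₂.m, π₁ (EuclideanSpace.single (Fin.natAdd Φ₁.m j) (1 : ℝ)) = 0 :=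
      fun j => by
    ext i
    rw [hπ₁, PiLp.single_apply, PiLp.zero_apply, if_neg (hne i j).symm]
  have hf₂ : ∀ j : Fin Φ₂.m, π₂ (EuclideanSpace.single (Fin.natAdd Φ₁.m j) (1 : ℝ)) =
      EuclideanSpace.single j 1 := fun j => by
    ext j'
    rw [hπ₂, PiLp.single_apply, PiLp.single_apply]
    simp only [Fin.natAdd_inj]
  -- the differential of the cut-off profile at the coordinates of `u`
  have hD := hφd _ (hR u hu)
  funext x
  simp only [Torus.CylindricalTest.grad, Torus.CylindricalTest.coords, Pi.add_apply, Pi.smul_apply]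
  rw [Fin.sum_univ_add, hD]
  simp only [_root_.add_apply, _root_.smul_apply,
    ContinuousLinearMap.comp_apply, hc₁, hc₂, he₁, he₂, hf₁, hf₂, hl, hr, map_zero, smul_eq_mul,
    mul_zero, add_zero, zero_add, Finset.smul_sum, smul_smul, Torus.CylindricalTest.coords]
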